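import Summits.ValiantsHypothesis.ValiantsHypothesis.Theorems.LacunarySymmetroidMatrixDescartesCensusV20Check

/-!
# `MatrixDescartes` census — a kernel-evaluable CHECKER for the 2-SIDON `V = 19` certificates (Cases A and B; definitions)

HONEST FRAMING.  Object-search cell `pub-symmetroid`; door-A item `DoorA26 = PosRootLawAt 2 6 19`
(stmt-ValiantsHypothesis-19979; OPEN, typed, never asserted) and its sharper support rows `PosRootLawOn 2 6 18 d`.  DEFINITIONS ONLY:
the certificate language and Boolean checker (`V19S.certOK`, `V19S.cellsOK`, `V19S.checkCells`) for engine-3 g15's door-A certificates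
on 2-SIDON supports (`slackcert.py` = Case A «one slack + windows», files `A_<d₅>.jsonl`; `zerocert.py` = Case B «one zero», files
`Z1_<d₅>.jsonl`; kit j236533; replay oracle `verify_box.py`, HOME/tools/engine3/g15), extending this lineage's `V = 20` checker
`…CensusV20Check` (atoms, order, named inequalities `G3 / RCS / W`, rows, factored constants, Farkas accumulation reused verbatim) in the
style of the Case-C checker `…CensusV19CCheck` (three-valued slot signs, zero-reduced Gram rows, null-letter triangles).  Nothing is proved
here: semantics in `…CensusV19SModel`, soundness in `…CensusV19SSound*`, data (kernel replays by `decide +kernel`) in `…CensusV19SBox*`.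
WHAT IS CHECKED.  `d = [d₀,…,d₅]` is 2-Sidon: the `21` atoms `q i = det S i` / `β i j` have distinct pair sums; `ord = V20.sortAtoms d`
lists them increasingly (VERIFIED by `V20.ordOK`); SLOT = POSITION `0 … 20`.  A hypothetical pencil with `19` distinct positive det-roots on `d`
whose `21` coefficients do NOT all alternate (the fully alternating case is a twenty in disguise and is excluded by the `V = 20` row, taken as a
hypothesis downstream) realises one CELL `(s, mode)`: orientation `s` (`true`: lowest coefficient positive) and EITHER `mode = A k` — all `21`
coefficients non-zero, signs `s·(−1)^p` for positions `p ≤ k` and `s·(−1)^{p+1}` for `p > k` (one repetition at `(k, k+1)`, `k < 20`) — OR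
`mode = B z` — the coefficient at position `z ≤ 20` vanishes and the `20` live ones alternate (`s·(−1)^p` for `p < z`, `s·(−1)^{p+1}` for
`p > z`).  ROWS (monomial inequalities in the `21` slot magnitudes): Newton-cone rows `c25 t` — mode `A k`: through positions `t−1, t, t+1`
with `t ∉ {k, k+1}` and gap weights over all `21` sums (`Census.newton_window_of_alternating`); mode `B z`: through the live sums of live index
`t−1, t, t+1` with weights over the `20` live sums —; WINDOW rows `win p q r` (mode `A k` only): the AM–GM shadow
`D^D (P_p x_p)^{D₂} (P_r x_r)^{D₁} ≤ D₁^{D₁} D₂^{D₂} (φ P_q x_q)^D` (`D₁ = E_q − E_p`, `D₂ = E_r − E_q`, `D = D₁ + D₂`, REDUCED weights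
`P_t = ∏_{u ∉ window} |E_t − E_u|`) of a two-term bound at a balance point of one of the three windows of four consecutive positions through
the repetition: LEFT `(k−2, k−1, k, k+1)` with `q = k−1`, `p = k−2`, `r ∈ {k, k+1}`, `φ = 1` (`Census.flank_balance_low_support`); RIGHT
`(k, …, k+3)` with `q = k+2`, `r = k+3`, `p ∈ {k, k+1}`, `φ = 1` (`…high_support`); MIDDLE `(k−1, …, k+2)` with `p = k−1`, `r = k+2`,
`q ∈ {k, k+1}`, `φ = 2`, admissible ONLY inside the branch `mid = some q` of a `branch2` certificate (`Census.window_balance_mid_support`: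
outer sum = middle sum `≤ 2·max`); single-positive-term / AM–GM rows of `G3, RCS, W ≥ 0` after deleting the terms through the zero atom.
CERTIFICATES: odd definite triangle (`sign`), odd triangle through a NULL letter (`signNull`, mode B with a vanishing `det S n`), all surviving
terms negative (`allneg`), Farkas combination (`lp`), single-monomial domination (`dom`) — and `branch2 c₁ c₂` (mode A): `c₁` checked with the
`k`-th, `c₂` with the `(k+1)`-th middle term doubled.  `checkCells d L certs` verifies the order and one certificate per listed cell; the `82`
cells of a support (`allCells`) are meant to be covered by eight slices (`sliceA`, `sliceB`).  Nothing here bears on the one-collision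
supports, on `ζ_sym(2,6)` over all supports, on `MatrixDescartes` (stmt-ValiantsHypothesis-18050) or on `VP ≠ VNP`.

[folklore] Bookkeeping / certificate replay; elementary.
-/

-- the D-0017 layout repeats a namespace component (single-conjunct summit); the `dupNamespace` linter flags it; name mandated.
set_option linter.dupNamespace false

namespace Summit.ValiantsHypothesis.ValiantsHypothesis.Theorems.LacunarySymmetroidMatrixDescartes.Census.V19S

open V20 (Atom allAtoms psum sortAtoms posOf ordOK sums qA cA Term PolySpec posl oddTrues FNat fval Row dist1 rowC25 rowOne rowAmgm
  bump bumps FRat insZ mulF divF numZ denZ negAt zero21 accumulate)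

/-! ## Cells: modes and contexts -/

/-- The mode of a `V = 19` cell on a 2-Sidon support: `A k` = one sign repetition at positions `(k, k+1)`, all coefficients non-zero;
`B z` = the coefficient at position `z` vanishes, the other `20` alternate. [folklore] -/
inductive Mode where
  /-- Case A: repetition at `(k, k+1)` -/ | A (k : ℕ)
  /-- Case B: zero at position `z` -/ | B (z : ℕ)
  deriving DecidableEq

/-- The pivot of a mode: positions `≤ pivot` carry the sign `s·(−1)^p`, positions `> pivot` the sign `s·(−1)^{p+1}`. [folklore] -/
def Mode.pivot : Mode → ℕ
  | .A k => k
  | .B z => z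

/-- A cell context: support, atom order (slot = position), the `21` sums, orientation, mode, and the doubled middle term of a
`branch2` branch (`none` outside a branch). [folklore] -/
structure Ctx where
  /-- the support -/
  d : List ℕ
  /-- the `21` atoms by increasing pair sum -/
  ord : List Atom
  /-- the `21` pair sums, increasing -/
  E : List ℕ
  /-- orientation: lowest coefficient positive -/
  s : Bool
  /-- mode of the cell -/
  mode : Mode
  /-- the doubled middle position inside a `branch2` branch -/
  mid : Option ℕ

/-- The context of the cell `(s, mode)` on `d` with order `ord`, in branch `mid`. [folklore] -/
def mkCtx (d : List ℕ) (ord : List Atom) (s : Bool) (mode : Mode) (mid : Option ℕ) : Ctx :=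
  { d := d, ord := ord, E := sums d ord, s := s, mode := mode, mid := mid }

/-- Is position `p` the ZERO position of the mode? [folklore] -/
def zeroSlot (m : Mode) (p : ℕ) : Bool :=
  match m with
  | .B z => p == z
  | .A _ => false

/-- Is position `p` NEGATIVE in the cell? (`s·(−1)^p` up to the pivot, flipped beyond it.) [folklore] -/
def negSlot (s : Bool) (m : Mode) (p : ℕ) : Bool := if p ≤ m.pivot then negAt s p else !negAt s p

/-- Slot (= position) of an atom. [folklore] -/
def Ctx.slot (c : Ctx) (a : Atom) : ℕ := posOf a c.ord

/-- Does the term contain the zero atom? [folklore] -/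
def termZero (c : Ctx) (T : Term) : Bool := T.2.any fun a => zeroSlot c.mode (c.slot a)

/-- Is the (non-zero) term NEGATIVE under the cell's signs? [folklore] -/
def termNeg (c : Ctx) (T : Term) : Bool :=
  xor (decide (T.1 < 0)) (oddTrues (T.2.map fun a => negSlot c.s c.mode (c.slot a)))

/-- Is the atom strictly POSITIVE (neither zero nor negative)? [folklore] -/
def atomPos (c : Ctx) (a : Atom) : Bool := !zeroSlot c.mode (c.slot a) && !negSlot c.s c.mode (c.slot a)

/-- Is the atom the zero atom? [folklore] -/
def atomZero (c : Ctx) (a : Atom) : Bool := zeroSlot c.mode (c.slot a)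

/-- Indices of the terms of `P` that are non-zero and POSITIVE. [folklore] -/
def posTerms (c : Ctx) (P : List Term) : List ℕ :=
  (List.range P.length).filter fun n => match P[n]? with
    | some T => !termZero c T && !termNeg c T
    | none => false

/-- Side condition of a named inequality: `RCS(i,j)` needs letter `i` definite (atom `q i` strictly positive). [folklore] -/
def defOK (c : Ctx) : PolySpec → Bool
  | .rcs i _ => atomPos c (qA i)
  | _ => true

/-- Validity of an inequality for row extraction (indices, side condition, exactly one non-zero positive term); returns its index. [folklore] -/
def posIndex (c : Ctx) (P : PolySpec) : Option ℕ :=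
  if P.valid && defOK c P then
    match posTerms c P.poly with
    | [p] => some p
    | _ => none
  else none

/-! ## Rows -/

/-- Position of the live sum of live index `i` when position `z` is dead. [folklore] -/
def liveSlot (z i : ℕ) : ℕ := if i < z then i else i + 1

/-- The Newton-cone row of mode `B z` through the live sums of live index `t−1, t, t+1`: `V20.rowC25` over the `20` live sums
(`E` with position `z` erased), slots remapped to positions. [folklore] -/
def rowC25B (E : List ℕ) (z t : ℕ) : Row :=
  let r := rowC25 (E.eraseIdx z) t
  { L := r.L.map (liveSlot z), R := r.R.map (liveSlot z), Bnum := r.Bnum, Bden := r.Bden }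

/-- The window of a window row `(p, q, r)` in mode `A k`, branch `mid`: start position `w₀` of the four consecutive positions and the
factor `φ`; `none` if the row is not licensed (see the module docstring). [folklore] -/
def winSpec (k : ℕ) (mid : Option ℕ) (p q r : ℕ) : Option (ℕ × ℕ) :=
  if 2 ≤ k ∧ p + 2 = k ∧ q + 1 = k ∧ (r = k ∨ r = k + 1) then some (k - 2, 1)
  else if k + 3 ≤ 20 ∧ q = k + 2 ∧ r = k + 3 ∧ (p = k ∨ p = k + 1) then some (k, 1)
  else if 1 ≤ k ∧ k + 2 ≤ 20 ∧ p + 1 = k ∧ r = k + 2 ∧ (q = k ∨ q = k + 1) ∧ mid = some q then some (k - 1, 2)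
  else none

/-- The four sums of the window starting at position `w₀`. [folklore] -/
def winSums (E : List ℕ) (w0 : ℕ) : List ℕ := [E.getD w0 0, E.getD (w0 + 1) 0, E.getD (w0 + 2) 0, E.getD (w0 + 3) 0]

/-- The REDUCED weight of the sum `e` for the window `W` (a list of four sums), to the power `n`, factored over the sums:
`∏_{u ∈ E, u ∉ W} |e − u|^n` (the factor of `u = e` is `1` by `dist1`). [folklore] -/
def redW (E W : List ℕ) (e n : ℕ) : FNat := E.map fun u => (if u ∈ W then 1 else dist1 e u, n)

/-- The window row `D^D (P_p x_p)^{D₂} (P_r x_r)^{D₁} ≤ D₁^{D₁} D₂^{D₂} (φ P_q x_q)^D` for the window starting at `w₀`. [folklore] -/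
def rowWin (E : List ℕ) (w0 φ p q r : ℕ) : Row :=
  let W := winSums E w0
  let ep := E.getD p 0
  let eq := E.getD q 0
  let er := E.getD r 0
  let D1 := eq - ep
  let D2 := er - eq
  { L := List.replicate D2 p ++ List.replicate D1 r
    R := List.replicate (D1 + D2) q
    Bnum := redW E W eq (D1 + D2) ++ [(φ, D1 + D2), (D1, D1), (D2, D2)]
    Bden := redW E W ep D2 ++ redW E W er D1 ++ [(D1 + D2, D1 + D2)] }

/-- Row specifications a certificate may use. [folklore] -/
inductive RowSpec where
  /-- Newton-cone row: mode A through positions `t−1, t, t+1`; mode B through live indices `t−1, t, t+1` -/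
  | c25 (t : ℕ)
  /-- window row through positions `p < q < r` (mode A) -/
  | win (p q r : ℕ)
  /-- `|tₙ| ≤ t₊` from the single-positive inequality `P` (term `n` non-zero) -/
  | one (P : PolySpec) (n : ℕ)
  /-- AM–GM over the non-zero negative terms `S` of the single-positive inequality `P` -/
  | amgm (P : PolySpec) (S : List ℕ)

/-- Build a row from its specification, checking its side conditions. [folklore] -/
def buildRow (c : Ctx) : RowSpec → Option Row
  | .c25 t =>
    match c.mode with
    | .A k => if 1 ≤ t ∧ t ≤ 19 ∧ t ≠ k ∧ t ≠ k + 1 ∧ k < 20 then some (rowC25 c.E t) else none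
    | .B z => if 1 ≤ t ∧ t ≤ 18 ∧ z ≤ 20 then some (rowC25B c.E z t) else none
  | .win p q r =>
    match c.mode with
    | .A k =>
      match winSpec k c.mid p q r with
      | some (w0, φ) => some (rowWin c.E w0 φ p q r)
      | none => none
    | .B _ => none
  | .one P n =>
    match posIndex c P with
    | some p => if decide (n < P.poly.length ∧ n ≠ p) && !termZero c (P.poly.getD n (0, [])) then some (rowOne c.ord P.poly p n) else none
    | none => none
  | .amgm P S =>
    match posIndex c P with
    | some p =>
      if decide (∀ j ∈ S, j < P.poly.length ∧ j ≠ p) && S.all (fun j => !termZero c (P.poly.getD j (0, []))) &&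
          decide S.Nodup && decide (S ≠ []) then
        some (rowAmgm c.ord P.poly p S) else none
    | none => none

/-- Build all rows of a list of specifications (with multipliers); `none` if one is invalid. [folklore] -/
def buildRows (c : Ctx) : List (RowSpec × ℕ) → Option (List (Row × ℕ))
  | [] => some []
  | (rs, n) :: rest =>
    match buildRow c rs, buildRows c rest with
    | some r, some rr => some ((r, n) :: rr)
    | _, _ => none

/-! ## Certificates -/

/-- A competitor of a domination certificate (as `V20.Comp`, with `V19S` rows). [folklore] -/
structure Comp where
  /-- index of the positive term -/
  k : ℕ
  /-- rows with multipliers -/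
  rows : List (RowSpec × ℕ)
  /-- root degree -/
  D : ℕ
  /-- numerator of the bound -/
  un : ℕ

/-- Leaf certificates that a cell carries no nineteen. [folklore] -/
inductive Cert0 where
  /-- odd triangle through three definite letters `i < j < k` -/
  | sign (i j k : ℕ)
  /-- odd triangle through the NULL letter `n` and definite letters `a < b` -/
  | signNull (n a b : ℕ)
  /-- every non-zero term of the inequality `P ≥ 0` is negative -/
  | allneg (P : PolySpec)
  /-- Farkas combination of rows -/
  | lp (rows : List (RowSpec × ℕ))
  /-- single-monomial domination of `P ≥ 0`: negative term `n0`, common denominator `ud`, competitors -/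
  | dom (P : PolySpec) (n0 : ℕ) (ud : ℕ) (comps : List Comp)

/-- Certificates: a leaf, or the middle-window disjunction with one leaf per branch. [folklore] -/
inductive Cert where
  /-- a leaf certificate (no window disjunction) -/
  | leaf (ct : Cert0)
  /-- `2·max(middle terms) ≥ outer sum`: `cK` with the `k`-th, `cK1` with the `(k+1)`-th middle term doubled -/
  | branch2 (cK cK1 : Cert0)

/-- Check an LP (Farkas) certificate: balance of exponents and `∏ Bden^N > ∏ Bnum^N`. [folklore] -/
def lpOK (c : Ctx) (rows : List (RowSpec × ℕ)) : Bool :=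
  match buildRows c rows with
  | none => false
  | some rs =>
    let acc := accumulate rs
    decide (acc.1 = acc.2.1) && decide (denZ acc.2.2 < numZ acc.2.2)

/-- Check one competitor of a domination certificate. [folklore] -/
def compOK (c : Ctx) (P : List Term) (n0 ud : ℕ) (cp : Comp) : Bool :=
  match buildRows c cp.rows with
  | none => false
  | some rs =>
    let acc := accumulate rs
    let T0 := P.getD n0 (0, [])
    let Tk := P.getD cp.k (0, [])
    let A := divF (mulF acc.2.2 [(cp.un * T0.1.natAbs, cp.D)] 1) [(Tk.1.natAbs * ud, cp.D)] 1
    decide (0 < cp.D) && decide (0 < cp.un) &&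
      decide (bumps acc.1 (posl c.ord T0.2) cp.D = bumps acc.2.1 (posl c.ord Tk.2) cp.D) &&
      decide (denZ A ≤ numZ A)

/-- Check a domination certificate. [folklore] -/
def domOK (c : Ctx) (P : PolySpec) (n0 ud : ℕ) (comps : List Comp) : Bool :=
  let poly := P.poly
  let pos := posTerms c poly
  P.valid && defOK c P && decide (n0 < poly.length) && !termZero c (poly.getD n0 (0, [])) && termNeg c (poly.getD n0 (0, [])) &&
    decide (0 < ud) &&
    decide (∀ k ∈ pos, ∃ cp ∈ comps, cp.k = k) && decide (∀ cp ∈ comps, cp.k ∈ pos) &&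
    decide ((comps.map Comp.k).Nodup) &&
    decide ((comps.map Comp.un).sum < ud) &&
    comps.all (compOK c poly n0 ud)

/-- Check an odd definite triangle: three definite letters, the three edge atoms non-zero with an odd number of negatives. [folklore] -/
def signOK (c : Ctx) (i j k : ℕ) : Bool :=
  decide (i < j ∧ j < k ∧ k < 6) && atomPos c (qA i) && atomPos c (qA j) && atomPos c (qA k) &&
    !atomZero c (cA i j) && !atomZero c (cA j k) && !atomZero c (cA i k) &&
    oddTrues [negSlot c.s c.mode (c.slot (cA i j)), negSlot c.s c.mode (c.slot (cA j k)), negSlot c.s c.mode (c.slot (cA i k))]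

/-- Check an odd triangle through a NULL letter `n` (its `q n` is the zero atom) and definite letters `a < b`. [folklore] -/
def signNullOK (c : Ctx) (n a b : ℕ) : Bool :=
  decide (n < 6 ∧ a < b ∧ b < 6 ∧ n ≠ a ∧ n ≠ b) && atomZero c (qA n) && atomPos c (qA a) && atomPos c (qA b) &&
    !atomZero c (cA n a) && !atomZero c (cA a b) && !atomZero c (cA n b) &&
    oddTrues [negSlot c.s c.mode (c.slot (cA n a)), negSlot c.s c.mode (c.slot (cA a b)), negSlot c.s c.mode (c.slot (cA n b))]

/-- Check an all-negative certificate: the inequality is valid, some term survives the zero atom, every surviving term is negative. [folklore] -/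
def allnegOK (c : Ctx) (P : PolySpec) : Bool :=
  let live := P.poly.filter fun T => !termZero c T
  P.valid && defOK c P && decide (live ≠ []) && live.all (termNeg c)

/-- Check a leaf certificate for a cell. [folklore] -/
def cert0OK (c : Ctx) : Cert0 → Bool
  | .sign i j k => signOK c i j k
  | .signNull n a b => signNullOK c n a b
  | .allneg P => allnegOK c P
  | .lp rows => lpOK c rows
  | .dom P n0 ud comps => domOK c P n0 ud comps

/-- Check a certificate for a cell: a leaf, or (mode A with a middle window) one leaf per branch of the disjunction. [folklore] -/
def certOK (c : Ctx) : Cert → Bool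
  | .leaf ct => cert0OK c ct
  | .branch2 cK cK1 =>
    match c.mode with
    | .A k => decide (1 ≤ k ∧ k + 2 ≤ 20) && cert0OK { c with mid := some k } cK && cert0OK { c with mid := some (k + 1) } cK1
    | .B _ => false

/-! ## Cells and slices -/

/-- The well-formed modes: `A k` with `k < 20`, `B z` with `z ≤ 20`. [folklore] -/
def Mode.ok : Mode → Bool
  | .A k => decide (k < 20)
  | .B z => decide (z ≤ 20)

/-- Check the certificates of a list of cells `(s, mode)` against their contexts (branch `none`). [folklore] -/
def cellsOK (d : List ℕ) (ord : List Atom) : List (Bool × Mode) → List Cert → Bool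
  | [], [] => true
  | (s, m) :: sm, ct :: cs => m.ok && certOK (mkCtx d ord s m none) ct && cellsOK d ord sm cs
  | _, _ => false

/-- Check a slice of cells of a support: compute and verify the 2-Sidon order, then every listed cell. [folklore] -/
def checkCells (d : List ℕ) (L : List (Bool × Mode)) (certs : List Cert) : Bool :=
  let ord := sortAtoms d
  ordOK d ord && cellsOK d ord L certs

/-- The slice of Case-A cells of orientation `s` with `lo ≤ k < hi`. [folklore] -/
def sliceA (s : Bool) (lo hi : ℕ) : List (Bool × Mode) := (List.range' lo (hi - lo)).map fun k => (s, Mode.A k)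

/-- The slice of Case-B cells of orientation `s` with `lo ≤ z < hi`. [folklore] -/
def sliceB (s : Bool) (lo hi : ℕ) : List (Bool × Mode) := (List.range' lo (hi - lo)).map fun z => (s, Mode.B z)

/-- All `82` cells of a support: `A k` (`k < 20`) and `B z` (`z ≤ 20`) in both orientations. [folklore] -/
def allCells : List (Bool × Mode) :=
  sliceA true 0 20 ++ sliceA false 0 20 ++ sliceB true 0 21 ++ sliceB false 0 21

end Summit.ValiantsHypothesis.ValiantsHypothesis.Theorems.LacunarySymmetroidMatrixDescartes.Census.V19S
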